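import Summits.AnomalousDissipation.AnomalousDissipation.Theorems.TaylorCertificatePair.Negative.Endgame

/-!
# The two CEILING consequences: at the far shear state and at the beat state

Crux `TaylorCertificates.TaylorCertificatePair` (stmt-AnomalousDissipation-13037), negative side
(cdisprove seat `refuter-cdisprove-stmt-AnomalousDissipation-13037-0`): support for the refutation
`Theorems/TaylorCertificatesTaylorCertificatePairRefutation.lean` (CEILING killed by an unresolved beat).
All statements are written over the tree's objects directly (no new definitions): single real modes
`Torus.realTrigPoly {k} (fun _ => z) = Re (e_k • z)`, mode sums `∑ₘ Torus.realTrigPoly {k m} (fun _ => z m)`,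
Fourier coefficients `mFourierCoeff (complexify ∘ ·)`, the transversal products `(fun j => (κ j : ℂ)) ⬝ᵥ z`.

* `ceil_shear`: CEILING at `uₑ` gives `F²/ν² − E ≤ c₁F𝔊 + (2√2+8π²)ΘF²/ν`;
* the two wave polarisations `(α/|q|)·q` and `ω β B̂` with the optimal phase `ω = −iζ̄/|ζ|`, and `beat_value`
  (`−π α β |q| |ζ|`);
* `coords_beat_eq` (the waves are invisible: same differential) and `ceil_beat`:
  `gain ≤ E + c₁F𝔊 + 6ΘF²/ν + 72π²ΘL²F²/ν`; small bookkeeping lemmas for the assembly.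
-/

noncomputable section

open MeasureTheory UnitAddTorus Matrix
open scoped InnerProductSpace ENNReal ComplexConjugate

namespace Summit.AnomalousDissipation.AnomalousDissipation.Theorems.TaylorCertificatePair.Negative

open Literature.Analysis.FunctionSpaces Literature.Analysis.FluidPDE

/-! ### CEILING at the far shear state -/

/-- The shear frequency lies in the ball of radius `1`. -/
theorem freqNormSq_shear_le : ∀ m : Fin 1, Torus.freqNormSq ((![(![0, 1, 0] : Fin 3 → ℤ)] : Fin 1 → (Fin 3 → ℤ)) m) ≤ ((1 : ℕ) : ℝ) ^ 2 := by
  intro m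
  fin_cases m
  simp [freqNormSq_e2]

/-- **CEILING at the far shear state forces a large resolved multiplier**:
`F²/ν² − E ≤ c₁ F 𝔊 + (2√2 + 8π²) Θ F²/ν`. -/
theorem ceil_shear {f : (UnitAddTorus (Fin 3)) → (EuclideanSpace ℝ (Fin 3))} (hf : Torus.IsSmooth f) {ν F : ℝ} (hν : 0 < ν) (hF : 0 < F)
    (hFf : Real.sqrt (∫ x, ‖f x‖ ^ 2) = F)
    (Φ : Torus.CylindricalTest (Fin 3)) {N : ℕ} (hΦ : ∀ i, Torus.fourierTruncate N (Φ.g i) = Φ.g i)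
    {θ Θ E : ℝ} (hθ : -Θ ≤ θ) (hθ' : θ ≤ 0)
    (u : (Torus.energySpace (Fin 3))) (hu : (((u : (Torus.energySpace (Fin 3))) : (Lp (EuclideanSpace ℝ (Fin 3)) 2 (volume : Measure (UnitAddTorus (Fin 3))))) : (UnitAddTorus (Fin 3)) → (EuclideanSpace ℝ (Fin 3))) =ᵐ[volume] (∑ mm, Torus.realTrigPoly {![(![0, 1, 0] : Fin 3 → ℤ)] mm} (fun _ => ![((((F) / (ν) * Real.sqrt 2 : ℝ) : ℂ) • (EuclideanSpace.complexify (EuclideanSpace.single (0 : Fin 3) (1 : ℝ)) : EuclideanSpace ℂ (Fin 3)))] mm)))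
    (hceil : ‖u‖ ^ 2 - E ≤
      Torus.nsGeneratorPairing ν f u (Φ.grad u) +
        2 * θ * (Torus.pairing ((u : (Torus.energySpace (Fin 3))) : (Lp (EuclideanSpace ℝ (Fin 3)) 2 (volume : Measure (UnitAddTorus (Fin 3))))) f -
          ν * (Torus.eGradNormSq (((u : (Torus.energySpace (Fin 3))) : (Lp (EuclideanSpace ℝ (Fin 3)) 2 (volume : Measure (UnitAddTorus (Fin 3))))) : (UnitAddTorus (Fin 3)) → (EuclideanSpace ℝ (Fin 3)))).toReal)) :
    F ^ 2 / ν ^ 2 - E ≤ (1 + 4 * Real.pi ^ 2 * Real.sqrt 2) * F * (Real.sqrt (∑ κ' ∈ Torus.freqBall N, ‖mFourierCoeff (EuclideanSpace.complexify ∘ (Φ.grad u)) κ'‖ ^ 2)) +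
      (2 * Real.sqrt 2 + 8 * Real.pi ^ 2) * Θ * F ^ 2 / ν := by
  set G := Φ.grad u with hGdef
  have hG : Torus.IsSmooth G := isSmooth_grad Φ u
  have hband : ∀ κ, (N : ℝ) ^ 2 < Torus.freqNormSq κ →
      mFourierCoeff (EuclideanSpace.complexify ∘ G) κ = 0 := fc_grad_eq_zero Φ hΦ u
  have hint : ∫ x, ‖(∑ mm, Torus.realTrigPoly {![(![0, 1, 0] : Fin 3 → ℤ)] mm} (fun _ => ![((((F) / (ν) * Real.sqrt 2 : ℝ) : ℂ) • (EuclideanSpace.complexify (EuclideanSpace.single (0 : Fin 3) (1 : ℝ)) : EuclideanSpace ℂ (Fin 3)))] mm)) x‖ ^ 2 = F ^ 2 / ν ^ 2 := integral_norm_sq_modes_shear hF.le hν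
  have hnorm : ‖u‖ ^ 2 = F ^ 2 / ν ^ 2 := by rw [norm_sq_of_ae hu, hint]
  rw [hnorm, nsGeneratorPairing_of_ae hu, pairing_of_ae hu, eGradNormSq_congr_ae' hu] at hceil
  -- the four terms
  have h1 : ∫ x, ⟪f x, G x⟫_ℝ ≤ F * (Real.sqrt (∑ κ' ∈ Torus.freqBall N, ‖mFourierCoeff (EuclideanSpace.complexify ∘ G) κ'‖ ^ 2)) := by
    have := integral_inner_le_coeffNorm (hf.memLp 2) hG.continuous hband
    rwa [hFf] at this
  have h2 : |∫ x, ⟪(∑ mm, Torus.realTrigPoly {![(![0, 1, 0] : Fin 3 → ℤ)] mm} (fun _ => ![((((F) / (ν) * Real.sqrt 2 : ℝ) : ℂ) • (EuclideanSpace.complexify (EuclideanSpace.single (0 : Fin 3) (1 : ℝ)) : EuclideanSpace ℂ (Fin 3)))] mm)) x, Torus.laplacian G x⟫_ℝ| ≤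
      F / ν * Real.sqrt 2 * (4 * Real.pi ^ 2) * (Real.sqrt (∑ κ' ∈ Torus.freqBall N, ‖mFourierCoeff (EuclideanSpace.complexify ∘ G) κ'‖ ^ 2)) := by
    have := laplacian_term_shear hG hband (((((F) / (ν) * Real.sqrt 2 : ℝ) : ℂ) • (EuclideanSpace.complexify (EuclideanSpace.single (0 : Fin 3) (1 : ℝ)) : EuclideanSpace ℂ (Fin 3))))
    rwa [norm_zsh hF.le hν] at this
  have h3 : ∫ x, ⟪Torus.fderiv G x ((∑ mm, Torus.realTrigPoly {![(![0, 1, 0] : Fin 3 → ℤ)] mm} (fun _ => ![((((F) / (ν) * Real.sqrt 2 : ℝ) : ℂ) • (EuclideanSpace.complexify (EuclideanSpace.single (0 : Fin 3) (1 : ℝ)) : EuclideanSpace ℂ (Fin 3)))] mm)) x), (∑ mm, Torus.realTrigPoly {![(![0, 1, 0] : Fin 3 → ℤ)] mm} (fun _ => ![((((F) / (ν) * Real.sqrt 2 : ℝ) : ℂ) • (EuclideanSpace.complexify (EuclideanSpace.single (0 : Fin 3) (1 : ℝ)) : EuclideanSpace ℂ (Fin 3)))] mm)) x⟫_ℝ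 = 0 :=
    inertial_shear hG (((((F) / (ν) * Real.sqrt 2 : ℝ) : ℂ) • (EuclideanSpace.complexify (EuclideanSpace.single (0 : Fin 3) (1 : ℝ)) : EuclideanSpace ℂ (Fin 3)))) (dotc_e2_zsh F ν)
  have h4 : |∫ x, ⟪(∑ mm, Torus.realTrigPoly {![(![0, 1, 0] : Fin 3 → ℤ)] mm} (fun _ => ![((((F) / (ν) * Real.sqrt 2 : ℝ) : ℂ) • (EuclideanSpace.complexify (EuclideanSpace.single (0 : Fin 3) (1 : ℝ)) : EuclideanSpace ℂ (Fin 3)))] mm)) x, f x⟫_ℝ| ≤ F / ν * Real.sqrt 2 * F := by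
    have := pairing_bound (k := ![(![0, 1, 0] : Fin 3 → ℤ)]) (z := ![((((F) / (ν) * Real.sqrt 2 : ℝ) : ℂ) • (EuclideanSpace.complexify (EuclideanSpace.single (0 : Fin 3) (1 : ℝ)) : EuclideanSpace ℂ (Fin 3)))]) hf
    have hs : (∑ m, ‖(![((((F) / (ν) * Real.sqrt 2 : ℝ) : ℂ) • (EuclideanSpace.complexify (EuclideanSpace.single (0 : Fin 3) (1 : ℝ)) : EuclideanSpace ℂ (Fin 3)))] : Fin 1 → (EuclideanSpace ℂ (Fin 3))) m‖) = ‖((((F) / (ν) * Real.sqrt 2 : ℝ) : ℂ) • (EuclideanSpace.complexify (EuclideanSpace.single (0 : Fin 3) (1 : ℝ)) : EuclideanSpace ℂ (Fin 3)))‖ := by simp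
    rwa [hs, norm_zsh hF.le hν, hFf] at this
  have h5 : 0 ≤ ν * (Torus.eGradNormSq ((∑ mm, Torus.realTrigPoly {![(![0, 1, 0] : Fin 3 → ℤ)] mm} (fun _ => ![((((F) / (ν) * Real.sqrt 2 : ℝ) : ℂ) • (EuclideanSpace.complexify (EuclideanSpace.single (0 : Fin 3) (1 : ℝ)) : EuclideanSpace ℂ (Fin 3)))] mm)))).toReal := by positivity
  have h6 : ν * (Torus.eGradNormSq ((∑ mm, Torus.realTrigPoly {![(![0, 1, 0] : Fin 3 → ℤ)] mm} (fun _ => ![((((F) / (ν) * Real.sqrt 2 : ℝ) : ℂ) • (EuclideanSpace.complexify (EuclideanSpace.single (0 : Fin 3) (1 : ℝ)) : EuclideanSpace ℂ (Fin 3)))] mm)))).toReal ≤ ν * (4 * Real.pi ^ 2 * F ^ 2 / ν ^ 2) := by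
    refine mul_le_mul_of_nonneg_left ?_ hν.le
    have := toReal_eGradNormSq_modes_le (k := ![(![0, 1, 0] : Fin 3 → ℤ)]) (z := ![((((F) / (ν) * Real.sqrt 2 : ℝ) : ℂ) • (EuclideanSpace.complexify (EuclideanSpace.single (0 : Fin 3) (1 : ℝ)) : EuclideanSpace ℂ (Fin 3)))]) freqNormSq_shear_le
    rw [hint] at this
    have e : 4 * Real.pi ^ 2 * ((1 : ℕ) : ℝ) ^ 2 * (F ^ 2 / ν ^ 2) = 4 * Real.pi ^ 2 * F ^ 2 / ν ^ 2 := by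
      push_cast; ring
    rwa [e] at this
  have h7 := energy_channel_bound hθ hθ' h4 h5 h6
  have h2' := (le_abs_self _).trans h2
  have hΘ : 0 ≤ Θ := by linarith
  have e1 : ν * (F / ν * Real.sqrt 2 * (4 * Real.pi ^ 2) * (Real.sqrt (∑ κ' ∈ Torus.freqBall N, ‖mFourierCoeff (EuclideanSpace.complexify ∘ G) κ'‖ ^ 2))) =
      4 * Real.pi ^ 2 * Real.sqrt 2 * F * (Real.sqrt (∑ κ' ∈ Torus.freqBall N, ‖mFourierCoeff (EuclideanSpace.complexify ∘ G) κ'‖ ^ 2)) := by field_simp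
  have e2' : 2 * Θ * (F / ν * Real.sqrt 2 * F) + 2 * Θ * (ν * (4 * Real.pi ^ 2 * F ^ 2 / ν ^ 2)) =
      (2 * Real.sqrt 2 + 8 * Real.pi ^ 2) * Θ * F ^ 2 / ν := by field_simp; ring
  have hνlap := mul_le_mul_of_nonneg_left h2' hν.le
  rw [e1] at hνlap
  rw [e2'] at h7
  rw [h3, add_zero] at hceil
  nlinarith [hceil, h1, hνlap, h7]

/-! ### Polarisations of the two beating waves -/

/-- `dotc` is linear in the vector. -/
theorem dotc_smul (κ : Fin 3 → ℤ) (c : ℂ) (w : (EuclideanSpace ℂ (Fin 3))) : ((fun j => ((κ) j : ℂ)) ⬝ᵥ (WithLp.ofLp ((c • w)))) = c * ((fun j => ((κ) j : ℂ)) ⬝ᵥ (WithLp.ofLp (w))) := by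
  simp [dotProduct, Finset.mul_sum, mul_left_comm]

/-- `dotc` of a complexified real vector is a real sum. -/
theorem dotc_complexify (κ : Fin 3 → ℤ) (B : (EuclideanSpace ℝ (Fin 3))) :
    ((fun j => ((κ) j : ℂ)) ⬝ᵥ (WithLp.ofLp ((EuclideanSpace.complexify B)))) = ((∑ j, (κ j : ℝ) * B j : ℝ) : ℂ) := by
  simp [dotProduct]

/-- `dotc κ` of the complexified cast of `μ` is the integer dot product `κ · μ`. -/
theorem dotc_complexify_castR (κ μ : Fin 3 → ℤ) :
    ((fun j => ((κ) j : ℂ)) ⬝ᵥ (WithLp.ofLp ((EuclideanSpace.complexify (WithLp.toLp 2 ((fun i => ((μ) i : ℝ)))))))) = ((κ ⬝ᵥ μ : ℤ) : ℂ) := by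
  rw [dotc_complexify]
  simp [dotProduct]

/-- Inner product with the complexified cast of an integer vector. -/
theorem inner_complexify_castR (g : (EuclideanSpace ℂ (Fin 3))) (μ : Fin 3 → ℤ) :
    ⟪g, EuclideanSpace.complexify (WithLp.toLp 2 ((fun i => ((μ) i : ℝ))))⟫_ℂ = conj (((fun j => ((μ) j : ℂ)) ⬝ᵥ (WithLp.ofLp (g)))) := by
  simp [PiLp.inner_apply, dotProduct, map_sum]

/-- The optimal phase is unimodular. -/
theorem norm_phase {ζ : ℂ} (hζ : ζ ≠ 0) : ‖(-Complex.I * conj (ζ) * ((‖ζ‖⁻¹ : ℝ) : ℂ))‖ = 1 := by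
  rw [norm_mul, norm_mul, norm_neg, Complex.norm_I, one_mul, Complex.norm_conj, Complex.norm_real,
    Real.norm_of_nonneg (inv_nonneg.2 (norm_nonneg ζ)), mul_inv_cancel₀ (norm_ne_zero_iff.2 hζ)]

/-- `ω ζ = -i |ζ|`. -/
theorem phase_mul_self (ζ : ℂ) (hζ : ζ ≠ 0) : (-Complex.I * conj (ζ) * ((‖ζ‖⁻¹ : ℝ) : ℂ)) * ζ = -Complex.I * (‖ζ‖ : ℂ) := by
  have h1 : conj ζ * ζ = ((‖ζ‖ ^ 2 : ℝ) : ℂ) := by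
    rw [mul_comm, Complex.mul_conj, Complex.normSq_eq_norm_sq]
  have hn : (‖ζ‖ : ℂ) ≠ 0 := by exact_mod_cast norm_ne_zero_iff.2 hζ
  calc -Complex.I * conj ζ * ((‖ζ‖⁻¹ : ℝ) : ℂ) * ζ
      = -Complex.I * ((‖ζ‖⁻¹ : ℝ) : ℂ) * (conj ζ * ζ) := by ring
    _ = -Complex.I * (‖ζ‖ : ℂ) := by
        rw [h1]
        have e : ((‖ζ‖⁻¹ : ℝ) : ℂ) * ((‖ζ‖ ^ 2 : ℝ) : ℂ) = (‖ζ‖ : ℂ) := by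
          push_cast
          field_simp
        calc -Complex.I * ((‖ζ‖⁻¹ : ℝ) : ℂ) * ((‖ζ‖ ^ 2 : ℝ) : ℂ)
            = -Complex.I * (((‖ζ‖⁻¹ : ℝ) : ℂ) * ((‖ζ‖ ^ 2 : ℝ) : ℂ)) := by ring
          _ = -Complex.I * (‖ζ‖ : ℂ) := by rw [e]

/-- `‖polA α q‖ = α`. -/
theorem norm_polA {α : ℝ} (hα : 0 ≤ α) {q : Fin 3 → ℤ} (hq : q ≠ 0) : ‖((((α) / Real.sqrt (Torus.freqNormSq (q)) : ℝ) : ℂ) • EuclideanSpace.complexify (WithLp.toLp 2 (fun i => ((q) i : ℝ))))‖ = α := by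
  have hfq : 0 < Torus.freqNormSq q := lt_of_lt_of_le one_pos (Torus.one_le_freqNormSq_of_ne_zero hq)
  have hs : 0 < Real.sqrt (Torus.freqNormSq q) := Real.sqrt_pos.2 hfq
  rw [norm_smul, Complex.norm_real, Real.norm_of_nonneg (by positivity), EuclideanSpace.norm_complexify]
  have : ‖(WithLp.toLp 2 ((fun i => ((q) i : ℝ))) : (EuclideanSpace ℝ (Fin 3)))‖ = Real.sqrt (Torus.freqNormSq q) := by
    rw [← Real.sqrt_sq (norm_nonneg _), norm_sq_toLp, ← freqNormSq_eq_castR_dot]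
  rw [this, div_mul_cancel₀ _ hs.ne']

/-- `‖polB β ζ B̂‖ = β` for a unit `B̂`. -/
theorem norm_polB (β : ℝ) (hβ : 0 ≤ β) {ζ : ℂ} (hζ : ζ ≠ 0) {B : (EuclideanSpace ℝ (Fin 3))} (hB : ‖B‖ = 1) :
    ‖(((-Complex.I * conj ((ζ)) * ((‖(ζ)‖⁻¹ : ℝ) : ℂ)) * ((β) : ℂ)) • EuclideanSpace.complexify (B))‖ = β := by
  rw [norm_smul, norm_mul, norm_phase hζ, Complex.norm_real, Real.norm_of_nonneg hβ,
    EuclideanSpace.norm_complexify, hB]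
  ring

/-- `dotc κ (polA α q) = (α/|q|) (κ · q)`. -/
theorem dotc_polA (κ : Fin 3 → ℤ) (α : ℝ) (q : Fin 3 → ℤ) :
    ((fun j => ((κ) j : ℂ)) ⬝ᵥ (WithLp.ofLp ((((((α) / Real.sqrt (Torus.freqNormSq (q)) : ℝ) : ℂ) • EuclideanSpace.complexify (WithLp.toLp 2 (fun i => ((q) i : ℝ)))))))) = ((α / Real.sqrt (Torus.freqNormSq q) : ℝ) : ℂ) * ((κ ⬝ᵥ q : ℤ) : ℂ) := by
  rw [dotc_smul, dotc_complexify_castR]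

/-- `dotc κ (polB β ζ B̂) = ω β (κ · B̂)`. -/
theorem dotc_polB (κ : Fin 3 → ℤ) (β : ℝ) (ζ : ℂ) (B : (EuclideanSpace ℝ (Fin 3))) :
    ((fun j => ((κ) j : ℂ)) ⬝ᵥ (WithLp.ofLp (((((-Complex.I * conj ((ζ)) * ((‖(ζ)‖⁻¹ : ℝ) : ℂ)) * ((β) : ℂ)) • EuclideanSpace.complexify (B)))))) = ((-Complex.I * conj (ζ) * ((‖ζ‖⁻¹ : ℝ) : ℂ)) * (β : ℂ)) * ((∑ j, (κ j : ℝ) * B j : ℝ) : ℂ) := by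
  rw [dotc_smul, dotc_complexify]

/-- `⟪g, polA α q⟫ = (α/|q|) conj(dotc q g)`. -/
theorem inner_polA (g : (EuclideanSpace ℂ (Fin 3))) (α : ℝ) (q : Fin 3 → ℤ) :
    ⟪g, ((((α) / Real.sqrt (Torus.freqNormSq (q)) : ℝ) : ℂ) • EuclideanSpace.complexify (WithLp.toLp 2 (fun i => ((q) i : ℝ))))⟫_ℂ = ((α / Real.sqrt (Torus.freqNormSq q) : ℝ) : ℂ) * conj (((fun j => ((q) j : ℂ)) ⬝ᵥ (WithLp.ofLp (g)))) := by
  rw [inner_smul_right, inner_complexify_castR]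

/-- `⟪g, polB β ζ B̂⟫ = ω β ⟪g, B̂⟫`. -/
theorem inner_polB (g : (EuclideanSpace ℂ (Fin 3))) (β : ℝ) (ζ : ℂ) (B : (EuclideanSpace ℝ (Fin 3))) :
    ⟪g, (((-Complex.I * conj ((ζ)) * ((‖(ζ)‖⁻¹ : ℝ) : ℂ)) * ((β) : ℂ)) • EuclideanSpace.complexify (B))⟫_ℂ = ((-Complex.I * conj (ζ) * ((‖ζ‖⁻¹ : ℝ) : ℂ)) * (β : ℂ)) * ⟪g, EuclideanSpace.complexify B⟫_ℂ := by
  rw [inner_smul_right]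

/-- **The value of the beat.** With the polarisations `polA`, `polB` the surviving inertial term is
`-π α β |q| |ζ|`, `ζ = ⟪Ĝ(q), B̂⟫`. -/
theorem beat_value (g : (EuclideanSpace ℂ (Fin 3))) {q : Fin 3 → ℤ} (hq : q ≠ 0) (α β : ℝ) (B : (EuclideanSpace ℝ (Fin 3)))
    (hζ : ⟪g, EuclideanSpace.complexify B⟫_ℂ ≠ 0) :
    Real.pi * (conj (((fun j => ((q) j : ℂ)) ⬝ᵥ (WithLp.ofLp ((((((α) / Real.sqrt (Torus.freqNormSq (q)) : ℝ) : ℂ) • EuclideanSpace.complexify (WithLp.toLp 2 (fun i => ((q) i : ℝ))))))))) * ⟪g, (((-Complex.I * conj (((⟪g, EuclideanSpace.complexify B⟫_ℂ))) * ((‖((⟪g, EuclideanSpace.complexify B⟫_ℂ))‖⁻¹ : ℝ) : ℂ)) * ((β) : ℂ)) • EuclideanSpace.complexify (B))⟫_ℂ).im =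
      -(Real.pi * α * β * Real.sqrt (Torus.freqNormSq q) * ‖⟪g, EuclideanSpace.complexify B⟫_ℂ‖) := by
  set ζ := ⟪g, EuclideanSpace.complexify B⟫_ℂ with hζdef
  have hfq : 0 < Torus.freqNormSq q := lt_of_lt_of_le one_pos (Torus.one_le_freqNormSq_of_ne_zero hq)
  have hs : 0 < Real.sqrt (Torus.freqNormSq q) := Real.sqrt_pos.2 hfq
  rw [dotc_polA, inner_polB, ← hζdef]
  have hqq : ((q ⬝ᵥ q : ℤ) : ℂ) = ((Torus.freqNormSq q : ℝ) : ℂ) := by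
    rw [freqNormSq_eq_castR_dot, castR_dot]; norm_cast
  rw [hqq]
  have hph : (-Complex.I * conj (ζ) * ((‖ζ‖⁻¹ : ℝ) : ℂ)) * (β : ℂ) * ζ = (β : ℂ) * (-Complex.I * (‖ζ‖ : ℂ)) := by
    rw [mul_assoc, mul_comm (β : ℂ) ζ, ← mul_assoc, phase_mul_self ζ hζ]; ring
  have e1 : conj ((((α / Real.sqrt (Torus.freqNormSq q) : ℝ) : ℂ)) * ((Torus.freqNormSq q : ℝ) : ℂ)) =
      ((α * Real.sqrt (Torus.freqNormSq q) : ℝ) : ℂ) := by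
    rw [map_mul, Complex.conj_ofReal, Complex.conj_ofReal]
    have : (α / Real.sqrt (Torus.freqNormSq q)) * Torus.freqNormSq q = α * Real.sqrt (Torus.freqNormSq q) := by
      rw [div_mul_eq_mul_div, div_eq_iff hs.ne', mul_assoc, Real.mul_self_sqrt hfq.le]
    exact_mod_cast congrArg (fun r : ℝ => (r : ℂ)) this
  rw [e1, hph]
  have e2c : (((α * Real.sqrt (Torus.freqNormSq q) : ℝ) : ℂ) * ((β : ℂ) * (-Complex.I * (‖ζ‖ : ℂ)))).im =
      -(α * Real.sqrt (Torus.freqNormSq q) * β * ‖ζ‖) := by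
    simp [Complex.mul_im, Complex.mul_re]
    ring
  rw [e2c]
  ring

/-! ### CEILING at the beat state -/


/-- The coordinates of the beat state and of the shear state agree: the unresolved waves are
invisible to the band-limited test fields. -/
theorem coords_beat_eq (Φ : Torus.CylindricalTest (Fin 3)) {N : ℕ}
    (hΦ : ∀ i, Torus.fourierTruncate N (Φ.g i) = Φ.g i) {p q : Fin 3 → ℤ} {zs zA zB : (EuclideanSpace ℂ (Fin 3))}
    (hNp : (N : ℝ) ^ 2 < Torus.freqNormSq p) (hNpq : (N : ℝ) ^ 2 < Torus.freqNormSq (p + q))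
    {uw ue : (Torus.energySpace (Fin 3))} (huw : (((uw : (Torus.energySpace (Fin 3))) : (Lp (EuclideanSpace ℝ (Fin 3)) 2 (volume : Measure (UnitAddTorus (Fin 3))))) : (UnitAddTorus (Fin 3)) → (EuclideanSpace ℝ (Fin 3))) =ᵐ[volume] (∑ mm, Torus.realTrigPoly {![(![0, 1, 0] : Fin 3 → ℤ), p, p + q] mm} (fun _ => ![zs, zA, zB] mm)))
    (hue : (((ue : (Torus.energySpace (Fin 3))) : (Lp (EuclideanSpace ℝ (Fin 3)) 2 (volume : Measure (UnitAddTorus (Fin 3))))) : (UnitAddTorus (Fin 3)) → (EuclideanSpace ℝ (Fin 3))) =ᵐ[volume] (∑ mm, Torus.realTrigPoly {![(![0, 1, 0] : Fin 3 → ℤ)] mm} (fun _ => ![zs] mm))) :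
    Φ.coords uw = Φ.coords ue := by
  ext i
  rw [coords_of_ae huw, coords_of_ae hue, integral_inner_modes_left (Φ.g_smooth i).integrable,
    integral_inner_modes_left (Φ.g_smooth i).integrable]
  simp only [Fin.sum_univ_three, Fin.sum_univ_one, Matrix.cons_val_zero, Matrix.cons_val_one,
    Matrix.cons_val_two, Matrix.head_cons, Matrix.tail_cons, Fin.isValue]
  rw [fc_g_eq_zero Φ hΦ i p hNp, fc_g_eq_zero Φ hΦ i (p + q) hNpq, inner_zero_right, inner_zero_right,
    Complex.zero_re, add_zero, add_zero]

set_option maxHeartbeats 400000 in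
/-- **CEILING at the beat state bounds the gain by the viscous price of the waves**:
`gain ≤ E + c₁ F 𝔊 + 6 Θ F²/ν + 72 π² Θ L² F²/ν`. -/
theorem ceil_beat {f : (UnitAddTorus (Fin 3)) → (EuclideanSpace ℝ (Fin 3))} (hf : Torus.IsSmooth f) {ν F : ℝ} (hν : 0 < ν) (hF : 0 < F)
    (hFf : Real.sqrt (∫ x, ‖f x‖ ^ 2) = F)
    (Φ : Torus.CylindricalTest (Fin 3)) {N : ℕ} (hΦ : ∀ i, Torus.fourierTruncate N (Φ.g i) = Φ.g i)
    {θ Θ E : ℝ} (hθ : -Θ ≤ θ) (hθ' : θ ≤ 0)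
    {p q : Fin 3 → ℤ} {zA zB : (EuclideanSpace ℂ (Fin 3))}
    (ue : (Torus.energySpace (Fin 3))) (hue : (((ue : (Torus.energySpace (Fin 3))) : (Lp (EuclideanSpace ℝ (Fin 3)) 2 (volume : Measure (UnitAddTorus (Fin 3))))) : (UnitAddTorus (Fin 3)) → (EuclideanSpace ℝ (Fin 3))) =ᵐ[volume] (∑ mm, Torus.realTrigPoly {![(![0, 1, 0] : Fin 3 → ℤ)] mm} (fun _ => ![((((F) / (ν) * Real.sqrt 2 : ℝ) : ℂ) • (EuclideanSpace.complexify (EuclideanSpace.single (0 : Fin 3) (1 : ℝ)) : EuclideanSpace ℂ (Fin 3)))] mm)))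
    (uw : (Torus.energySpace (Fin 3))) (huw : (((uw : (Torus.energySpace (Fin 3))) : (Lp (EuclideanSpace ℝ (Fin 3)) 2 (volume : Measure (UnitAddTorus (Fin 3))))) : (UnitAddTorus (Fin 3)) → (EuclideanSpace ℝ (Fin 3))) =ᵐ[volume] (∑ mm, Torus.realTrigPoly {![(![0, 1, 0] : Fin 3 → ℤ), p, p + q] mm} (fun _ => ![((((F) / (ν) * Real.sqrt 2 : ℝ) : ℂ) • (EuclideanSpace.complexify (EuclideanSpace.single (0 : Fin 3) (1 : ℝ)) : EuclideanSpace ℂ (Fin 3))), zA, zB] mm)))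
    (hA : ((fun j => ((p) j : ℂ)) ⬝ᵥ (WithLp.ofLp (zA))) = 0) (hB : ((fun j => (((p + q)) j : ℂ)) ⬝ᵥ (WithLp.ofLp (zB))) = 0)
    (hzA : ‖zA‖ ≤ F / (2 * ν)) (hzB : ‖zB‖ ≤ F / (2 * ν))
    (hNp : (N : ℝ) ^ 2 < Torus.freqNormSq p) (hNpq : (N : ℝ) ^ 2 < Torus.freqNormSq (p + q))
    (hN1 : (N : ℝ) ^ 2 < Torus.freqNormSq (p + (![0, 1, 0] : Fin 3 → ℤ))) (hN2 : (N : ℝ) ^ 2 < Torus.freqNormSq (p - (![0, 1, 0] : Fin 3 → ℤ)))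
    (hN3 : (N : ℝ) ^ 2 < Torus.freqNormSq (p + q + (![0, 1, 0] : Fin 3 → ℤ))) (hN4 : (N : ℝ) ^ 2 < Torus.freqNormSq (p + q - (![0, 1, 0] : Fin 3 → ℤ)))
    (hN5 : (N : ℝ) ^ 2 < Torus.freqNormSq (p + (p + q)))
    {L : ℕ} (hL : ∀ m, Torus.freqNormSq ((![(![0, 1, 0] : Fin 3 → ℤ), p, p + q] : Fin 3 → (Fin 3 → ℤ)) m) ≤ (L : ℝ) ^ 2)
    (hAq : ⟪(mFourierCoeff (EuclideanSpace.complexify ∘ (Φ.grad ue)) (-q)), zA⟫_ℂ = 0)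
    {gain : ℝ}
    (hbeat : Real.pi * (conj (((fun j => ((q) j : ℂ)) ⬝ᵥ (WithLp.ofLp (zA)))) * ⟪(mFourierCoeff (EuclideanSpace.complexify ∘ (Φ.grad ue)) q), zB⟫_ℂ).im ≤ -gain)
    (hceil : ‖uw‖ ^ 2 - E ≤
      Torus.nsGeneratorPairing ν f uw (Φ.grad uw) +
        2 * θ * (Torus.pairing ((uw : (Torus.energySpace (Fin 3))) : (Lp (EuclideanSpace ℝ (Fin 3)) 2 (volume : Measure (UnitAddTorus (Fin 3))))) f -
          ν * (Torus.eGradNormSq (((uw : (Torus.energySpace (Fin 3))) : (Lp (EuclideanSpace ℝ (Fin 3)) 2 (volume : Measure (UnitAddTorus (Fin 3))))) : (UnitAddTorus (Fin 3)) → (EuclideanSpace ℝ (Fin 3)))).toReal)) :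
    gain ≤ E + (1 + 4 * Real.pi ^ 2 * Real.sqrt 2) * F * (Real.sqrt (∑ κ' ∈ Torus.freqBall N, ‖mFourierCoeff (EuclideanSpace.complexify ∘ (Φ.grad ue)) κ'‖ ^ 2)) + 6 * Θ * F ^ 2 / ν +
      72 * Real.pi ^ 2 * Θ * (L : ℝ) ^ 2 * F ^ 2 / ν := by
  set G := Φ.grad ue with hGdef
  have hG : Torus.IsSmooth G := isSmooth_grad Φ ue
  have hband : ∀ κ, (N : ℝ) ^ 2 < Torus.freqNormSq κ →
      mFourierCoeff (EuclideanSpace.complexify ∘ G) κ = 0 := fc_grad_eq_zero Φ hΦ ue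
  have hband' : ∀ κ, (N : ℝ) ^ 2 < Torus.freqNormSq κ → (mFourierCoeff (EuclideanSpace.complexify ∘ G) κ) = 0 := hband
  -- the beat state has the same differential
  have hgrad : Φ.grad uw = G := by
    rw [hGdef]
    exact grad_eq_of_coords_eq Φ (coords_beat_eq Φ hΦ hNp hNpq huw hue)
  rw [hgrad, nsGeneratorPairing_of_ae huw, pairing_of_ae huw, eGradNormSq_congr_ae' huw] at hceil
  -- norms of the three polarisations
  have hzs : ‖((((F) / (ν) * Real.sqrt 2 : ℝ) : ℂ) • (EuclideanSpace.complexify (EuclideanSpace.single (0 : Fin 3) (1 : ℝ)) : EuclideanSpace ℂ (Fin 3)))‖ = F / ν * Real.sqrt 2 := norm_zsh hF.le hν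
  have hsum : ∑ m, ‖(![((((F) / (ν) * Real.sqrt 2 : ℝ) : ℂ) • (EuclideanSpace.complexify (EuclideanSpace.single (0 : Fin 3) (1 : ℝ)) : EuclideanSpace ℂ (Fin 3))), zA, zB] : Fin 3 → (EuclideanSpace ℂ (Fin 3))) m‖ ≤ 3 * F / ν := by
    simp only [Fin.sum_univ_three, Matrix.cons_val_zero, Matrix.cons_val_one, Matrix.cons_val_two,
      Matrix.head_cons, Matrix.tail_cons, Fin.isValue]
    rw [hzs]
    have h2 : Real.sqrt 2 ≤ 3 / 2 := by rw [Real.sqrt_le_left (by norm_num)]; norm_num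
    have : F / ν * Real.sqrt 2 ≤ F / ν * (3 / 2) := mul_le_mul_of_nonneg_left h2 (by positivity)
    have e : F / ν * (3 / 2) + F / (2 * ν) + F / (2 * ν) = 3 * F / ν - F / (2 * ν) := by field_simp; ring
    have hpos : 0 ≤ F / (2 * ν) := by positivity
    linarith
  have hsum0 : 0 ≤ ∑ m, ‖(![((((F) / (ν) * Real.sqrt 2 : ℝ) : ℂ) • (EuclideanSpace.complexify (EuclideanSpace.single (0 : Fin 3) (1 : ℝ)) : EuclideanSpace ℂ (Fin 3))), zA, zB] : Fin 3 → (EuclideanSpace ℂ (Fin 3))) m‖ := Finset.sum_nonneg fun m _ => norm_nonneg _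
  -- (1) the left-hand side is nonnegative
  have h0 : 0 ≤ ‖uw‖ ^ 2 := sq_nonneg _
  -- (2) forcing term
  have h1 : ∫ x, ⟪f x, G x⟫_ℝ ≤ F * (Real.sqrt (∑ κ' ∈ Torus.freqBall N, ‖mFourierCoeff (EuclideanSpace.complexify ∘ G) κ'‖ ^ 2)) := by
    have := integral_inner_le_coeffNorm (hf.memLp 2) hG.continuous hband
    rwa [hFf] at this
  -- (3) Laplacian term
  have h2 : |∫ x, ⟪(∑ mm, Torus.realTrigPoly {![(![0, 1, 0] : Fin 3 → ℤ), p, p + q] mm} (fun _ => ![((((F) / (ν) * Real.sqrt 2 : ℝ) : ℂ) • (EuclideanSpace.complexify (EuclideanSpace.single (0 : Fin 3) (1 : ℝ)) : EuclideanSpace ℂ (Fin 3))), zA, zB] mm)) x, Torus.laplacian G x⟫_ℝ| ≤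
      F / ν * Real.sqrt 2 * (4 * Real.pi ^ 2) * (Real.sqrt (∑ κ' ∈ Torus.freqBall N, ‖mFourierCoeff (EuclideanSpace.complexify ∘ G) κ'‖ ^ 2)) := by
    have := laplacian_term_three hG hband (((((F) / (ν) * Real.sqrt 2 : ℝ) : ℂ) • (EuclideanSpace.complexify (EuclideanSpace.single (0 : Fin 3) (1 : ℝ)) : EuclideanSpace ℂ (Fin 3)))) zA zB (hband' p hNp) (hband' (p + q) hNpq)
    rwa [hzs] at this
  -- (4) the beat
  have h3 : ∫ x, ⟪Torus.fderiv G x ((∑ mm, Torus.realTrigPoly {![(![0, 1, 0] : Fin 3 → ℤ), p, p + q] mm} (fun _ => ![((((F) / (ν) * Real.sqrt 2 : ℝ) : ℂ) • (EuclideanSpace.complexify (EuclideanSpace.single (0 : Fin 3) (1 : ℝ)) : EuclideanSpace ℂ (Fin 3))), zA, zB] mm)) x),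
      (∑ mm, Torus.realTrigPoly {![(![0, 1, 0] : Fin 3 → ℤ), p, p + q] mm} (fun _ => ![((((F) / (ν) * Real.sqrt 2 : ℝ) : ℂ) • (EuclideanSpace.complexify (EuclideanSpace.single (0 : Fin 3) (1 : ℝ)) : EuclideanSpace ℂ (Fin 3))), zA, zB] mm)) x⟫_ℝ ≤ -gain := by
    rw [inertial_three hG p q (((((F) / (ν) * Real.sqrt 2 : ℝ) : ℂ) • (EuclideanSpace.complexify (EuclideanSpace.single (0 : Fin 3) (1 : ℝ)) : EuclideanSpace ℂ (Fin 3)))) zA zB (dotc_e2_zsh F ν) hA hB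
      (hband' _ (by rwa [add_comm])) (hband' _ hN2) (hband' _ hN1)
      (hband' _ (by rwa [← neg_sub, Torus.freqNormSq_neg])) (hband' _ (by rwa [add_comm]))
      (hband' _ hN4) (hband' _ hN3) (hband' _ (by rwa [← neg_sub, Torus.freqNormSq_neg]))
      (hband' _ hN5) (hband' _ (by rwa [add_comm])) (fc_grad_zero Φ ue) hAq]
    exact hbeat
  -- (5) pairing with the force
  have h4 : |∫ x, ⟪(∑ mm, Torus.realTrigPoly {![(![0, 1, 0] : Fin 3 → ℤ), p, p + q] mm} (fun _ => ![((((F) / (ν) * Real.sqrt 2 : ℝ) : ℂ) • (EuclideanSpace.complexify (EuclideanSpace.single (0 : Fin 3) (1 : ℝ)) : EuclideanSpace ℂ (Fin 3))), zA, zB] mm)) x, f x⟫_ℝ| ≤ 3 * F / ν * F := by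
    have := pairing_bound (k := ![(![0, 1, 0] : Fin 3 → ℤ), p, p + q]) (z := ![((((F) / (ν) * Real.sqrt 2 : ℝ) : ℂ) • (EuclideanSpace.complexify (EuclideanSpace.single (0 : Fin 3) (1 : ℝ)) : EuclideanSpace ℂ (Fin 3))), zA, zB]) hf
    rw [hFf] at this
    exact this.trans (mul_le_mul_of_nonneg_right hsum hF.le)
  -- (6) the viscous price of the waves
  have hint : ∫ x, ‖(∑ mm, Torus.realTrigPoly {![(![0, 1, 0] : Fin 3 → ℤ), p, p + q] mm} (fun _ => ![((((F) / (ν) * Real.sqrt 2 : ℝ) : ℂ) • (EuclideanSpace.complexify (EuclideanSpace.single (0 : Fin 3) (1 : ℝ)) : EuclideanSpace ℂ (Fin 3))), zA, zB] mm)) x‖ ^ 2 ≤ (3 * F / ν) ^ 2 :=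
    integral_norm_sq_modes_le.trans (pow_le_pow_left₀ hsum0 hsum 2)
  have h5 : 0 ≤ ν * (Torus.eGradNormSq ((∑ mm, Torus.realTrigPoly {![(![0, 1, 0] : Fin 3 → ℤ), p, p + q] mm} (fun _ => ![((((F) / (ν) * Real.sqrt 2 : ℝ) : ℂ) • (EuclideanSpace.complexify (EuclideanSpace.single (0 : Fin 3) (1 : ℝ)) : EuclideanSpace ℂ (Fin 3))), zA, zB] mm)))).toReal := by
    positivity
  have h6 : ν * (Torus.eGradNormSq ((∑ mm, Torus.realTrigPoly {![(![0, 1, 0] : Fin 3 → ℤ), p, p + q] mm} (fun _ => ![((((F) / (ν) * Real.sqrt 2 : ℝ) : ℂ) • (EuclideanSpace.complexify (EuclideanSpace.single (0 : Fin 3) (1 : ℝ)) : EuclideanSpace ℂ (Fin 3))), zA, zB] mm)))).toReal ≤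
      ν * (4 * Real.pi ^ 2 * (L : ℝ) ^ 2 * (3 * F / ν) ^ 2) := by
    refine mul_le_mul_of_nonneg_left ?_ hν.le
    exact (toReal_eGradNormSq_modes_le hL).trans (mul_le_mul_of_nonneg_left hint (by positivity))
  have h7 := energy_channel_bound hθ hθ' h4 h5 h6
  -- assemble
  have hΘ : 0 ≤ Θ := by linarith
  have h2' := (le_abs_self _).trans h2
  have hνlap := mul_le_mul_of_nonneg_left h2' hν.le
  have e1 : ν * (F / ν * Real.sqrt 2 * (4 * Real.pi ^ 2) * (Real.sqrt (∑ κ' ∈ Torus.freqBall N, ‖mFourierCoeff (EuclideanSpace.complexify ∘ G) κ'‖ ^ 2))) =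
      4 * Real.pi ^ 2 * Real.sqrt 2 * F * (Real.sqrt (∑ κ' ∈ Torus.freqBall N, ‖mFourierCoeff (EuclideanSpace.complexify ∘ G) κ'‖ ^ 2)) := by field_simp
  rw [e1] at hνlap
  have e2' : 2 * Θ * (3 * F / ν * F) + 2 * Θ * (ν * (4 * Real.pi ^ 2 * (L : ℝ) ^ 2 * (3 * F / ν) ^ 2)) =
      6 * Θ * F ^ 2 / ν + 72 * Real.pi ^ 2 * Θ * (L : ℝ) ^ 2 * F ^ 2 / ν := by
    field_simp; ring
  rw [e2'] at h7
  have hc : (1 + 4 * Real.pi ^ 2 * Real.sqrt 2) * F * (Real.sqrt (∑ κ' ∈ Torus.freqBall N, ‖mFourierCoeff (EuclideanSpace.complexify ∘ G) κ'‖ ^ 2)) = F * (Real.sqrt (∑ κ' ∈ Torus.freqBall N, ‖mFourierCoeff (EuclideanSpace.complexify ∘ G) κ'‖ ^ 2)) + 4 * Real.pi ^ 2 * Real.sqrt 2 * F * (Real.sqrt (∑ κ' ∈ Torus.freqBall N, ‖mFourierCoeff (EuclideanSpace.complexify ∘ G) κ'‖ ^ 2)) := by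
    ring
  rw [hc]
  rw [norm_sq_of_ae huw] at h0
  nlinarith [hceil, h0, h1, hνlap, h3, h7]

/-! ### The refutation -/

/-- Membership facts for the three-mode frequency and polarisation vectors. -/
theorem three_ne_zero {p q : Fin 3 → ℤ} (hp : p ≠ 0) (hpq : p + q ≠ 0) :
    ∀ m, (![(![0, 1, 0] : Fin 3 → ℤ), p, p + q] : Fin 3 → (Fin 3 → ℤ)) m ≠ 0 := by
  intro m
  fin_cases m
  · exact e2_ne_zero
  · exact hp
  · exact hpq

/-- Transversality of the three polarisations of the beat state. -/
theorem three_dotc {F ν : ℝ} {p q : Fin 3 → ℤ} {zA zB : (EuclideanSpace ℂ (Fin 3))} (hA : ((fun j => ((p) j : ℂ)) ⬝ᵥ (WithLp.ofLp (zA))) = 0)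
    (hB : ((fun j => (((p + q)) j : ℂ)) ⬝ᵥ (WithLp.ofLp (zB))) = 0) :
    ∀ m, ((fun j => ((((![(![0, 1, 0] : Fin 3 → ℤ), p, p + q] : Fin 3 → (Fin 3 → ℤ)) m)) j : ℂ)) ⬝ᵥ (WithLp.ofLp (((![((((F) / (ν) * Real.sqrt 2 : ℝ) : ℂ) • (EuclideanSpace.complexify (EuclideanSpace.single (0 : Fin 3) (1 : ℝ)) : EuclideanSpace ℂ (Fin 3))), zA, zB] : Fin 3 → (EuclideanSpace ℂ (Fin 3))) m)))) = 0 := by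
  intro m
  fin_cases m
  · exact dotc_e2_zsh F ν
  · exact hA
  · exact hB

/-- The three frequencies of the beat state lie in the ball of radius `L`. -/
theorem three_freq_le {p q : Fin 3 → ℤ} {L : ℕ} (hL1 : (1 : ℝ) ≤ (L : ℝ) ^ 2)
    (hp : Torus.freqNormSq p ≤ (L : ℝ) ^ 2) (hpq : Torus.freqNormSq (p + q) ≤ (L : ℝ) ^ 2) :
    ∀ m, Torus.freqNormSq ((![(![0, 1, 0] : Fin 3 → ℤ), p, p + q] : Fin 3 → (Fin 3 → ℤ)) m) ≤ (L : ℝ) ^ 2 := by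
  intro m
  fin_cases m
  · simpa [freqNormSq_e2] using hL1
  · exact hp
  · exact hpq

/-- The shear frequency vector has nonzero entries. -/
theorem one_ne_zero' : ∀ m, (![(![0, 1, 0] : Fin 3 → ℤ)] : Fin 1 → (Fin 3 → ℤ)) m ≠ 0 := by
  intro m; fin_cases m; exact e2_ne_zero

/-- Transversality of the shear polarisation vector. -/
theorem one_dotc (F ν : ℝ) : ∀ m, ((fun j => ((((![(![0, 1, 0] : Fin 3 → ℤ)] : Fin 1 → (Fin 3 → ℤ)) m)) j : ℂ)) ⬝ᵥ (WithLp.ofLp (((![((((F) / (ν) * Real.sqrt 2 : ℝ) : ℂ) • (EuclideanSpace.complexify (EuclideanSpace.single (0 : Fin 3) (1 : ℝ)) : EuclideanSpace ℂ (Fin 3)))] : Fin 1 → (EuclideanSpace ℂ (Fin 3))) m)))) = 0 := by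
  intro m; fin_cases m; exact dotc_e2_zsh F ν

/-- A frequency of positive length is nonzero. -/
theorem ne_zero_of_freqNormSq_pos {p : Fin 3 → ℤ} {a : ℝ} (ha : 0 ≤ a) (h : a < Torus.freqNormSq p) : p ≠ 0 := by
  rintro rfl
  rw [Torus.freqNormSq_zero] at h
  linarith

end Summit.AnomalousDissipation.AnomalousDissipation.Theorems.TaylorCertificatePair.Negative
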